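import Mathlib
import Summits.Ventures.HodgeRepro.OcticCMPointSixSign

/-!
# OcticCMPointSixCard — `|𝔭³/𝔭⁶| = 125 = |𝒪/𝔭⁶|^{1/2}`, and the conductor-`6` root numbers with `κ = 1/125`

Blind re-derivation cell `pub-hodge-repro`, seat night-2 (gen 5).  Target tree path
`lean/Summits/Ventures/HodgeRepro/OcticCMPointSixCard.lean`.  Closes the REMARK of `OcticCMPointSixSign.lean`: the
cardinalities of the quotient model are computed by three kernel/range counts, each anchored on
`OcticCMPointEightIdeal.card_I5` (`|5R8| = 625`):

* `|J| = 25` (`natCard_J`): multiplication by `w²` maps `5R8` onto `J = 5w²R8` with kernel `Ann(w²) ∩ 5R8 = J`, so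
  `|5R8| = |J|²`;
* `|𝒪/𝔭⁶| = 5⁶` (`natCard_R6`): `|R8| = |J| · |R8 ⧸ J|`;
* `|I₆| = 125` (`natCard_I6`, `card_I6`): multiplication by `q(w³)` on `R6` has kernel and range `I₆` (`w³ y ∈ J` forces
  `y ∈ (w³)`: the two lowest coordinates of `w³ y` are `20c₁, 20c₂`, those of an element of `J` are `0`), so
  `|R6| = |I₆|²`.

Hence `κ = 1/125` and **`eps_six_half`**: `ε(½, ρ, ψ̃₆) = ρ(ϖ)^n ρ(a₀)^{−1}` with Kudla's constant in numbers.

**What this is not.**  Nothing here says anything about the status of the Hodge conjecture for CM abelian varieties,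
which is NOT proved.
-/

set_option autoImplicit false

noncomputable section

open Polynomial Classical

namespace Summit.Ventures.HodgeRepro.PeriodCloser

namespace SixModel

open GaussSumStability EightModel

/-! ### `|J| = 25` -/

/-- `J ⊆ 5R8`. -/
theorem J_le_I5 (y : R8) (hy : y ∈ J) : y ∈ I5 := by
  obtain ⟨b, rfl⟩ := (mem_J_iff y).1 hy
  exact (mem_I5_iff _).2 ⟨w ^ 2 * b, by ring⟩

/-- Multiplication by `w²` on `5R8`, as an additive map `5R8 → R8`. -/
def mulWsq : I5 →+ R8 where
  toFun y := w ^ 2 * (y : R8)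
  map_zero' := by simp
  map_add' y z := by simp [mul_add]

/-- The range of `w² · : 5R8 → R8` is `J`. -/
theorem mulWsq_range : mulWsq.range = J.toAddSubgroup := by
  ext y
  rw [AddMonoidHom.mem_range, Submodule.mem_toAddSubgroup, mem_J_iff]
  constructor
  · rintro ⟨⟨z, hz⟩, hzy⟩
    obtain ⟨b, rfl⟩ := (mem_I5_iff z).1 hz
    exact ⟨b, by rw [← hzy]; show w ^ 2 * (5 * b) = 5 * w ^ 2 * b; ring⟩
  · rintro ⟨b, rfl⟩
    exact ⟨⟨5 * b, (mem_I5_iff _).2 ⟨b, rfl⟩⟩, by show w ^ 2 * (5 * b) = 5 * w ^ 2 * b; ring⟩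

/-- The kernel of `w² · : 5R8 → R8` is `J` (inside `5R8`). -/
theorem mulWsq_ker_card : Nat.card mulWsq.ker = Nat.card J := by
  refine Nat.card_congr ⟨fun x => ⟨(x : I5), ?_⟩, fun j => ⟨⟨(j : R8), J_le_I5 _ j.2⟩, ?_⟩, ?_, ?_⟩
  · exact ann_w_sq (AddMonoidHom.mem_ker.1 x.2)
  · rw [AddMonoidHom.mem_ker]
    show w ^ 2 * (j : R8) = 0
    obtain ⟨b, hb⟩ := (mem_J_iff _).1 j.2
    rw [hb]
    have h25 := twentyfive_eq_zero
    have h4 := w_pow_four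
    linear_combination (5 * b) * h4 + (4 * b + 4 * w ^ 2 * b) * h25
  · intro x; rfl
  · intro j; rfl

/-- **`|J| = 25`**: `|5R8| = |ker| · |range| = |J|²`, and `|5R8| = 625`. -/
theorem natCard_J : Nat.card J = 25 := by
  have h1 := AddSubgroup.card_eq_card_quotient_mul_card_addSubgroup mulWsq.ker
  have h2 : Nat.card (I5 ⧸ mulWsq.ker) = Nat.card mulWsq.range :=
    Nat.card_congr (QuotientAddGroup.quotientKerEquivRange mulWsq).toEquiv
  rw [h2, mulWsq_range, mulWsq_ker_card] at h1
  have h3 : Nat.card I5 = 25 * 25 := by rw [Nat.card_eq_fintype_card, card_I5]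
  have h4 : Nat.card J.toAddSubgroup = Nat.card J :=
    Nat.card_congr (Equiv.subtypeEquivRight fun x => Submodule.mem_toAddSubgroup J)
  rw [h4, h3] at h1
  exact Nat.mul_self_inj.1 h1.symm

/-! ### `|𝒪/𝔭⁶| = 5⁶` -/

/-- **`|𝒪/𝔭⁶| = 15625 = 5⁶`**: `|R8| = |J| · |R8 ⧸ J|`. -/
theorem natCard_R6 : Nat.card R6 = 15625 := by
  have h := Submodule.card_eq_card_quotient_mul_card J
  have h8 : Nat.card R8 = 390625 := by rw [Nat.card_eq_fintype_card, card_R8]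
  rw [natCard_J, h8] at h
  show Nat.card (R8 ⧸ J) = 15625
  omega

/-! ### `|I₆| = 125` -/

/-- `5w² b` in coordinates: `(5 : ℤ/25) • (w² b)`, whose coordinates are `5 · (20c₂, 20c₃, c₀ + 20c₂, c₁ + 20c₃)`. -/
theorem coords_five_w_sq_mul (b : R8) (i : Fin 4) :
    b4.repr (5 * w ^ 2 * b) i = 5 * ![20 * b4.repr b 2, 20 * b4.repr b 3, b4.repr b 0 + 20 * b4.repr b 2,
      b4.repr b 1 + 20 * b4.repr b 3] i := by
  have h5 : (5 : R8) * w ^ 2 * b = (5 : ZMod 25) • (w ^ 2 * b) := by rw [Algebra.smul_def, map_ofNat]; ring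
  have hw : w ^ 2 * b = (20 * b4.repr b 2) • (1 : R8) + (20 * b4.repr b 3) • w +
      (b4.repr b 0 + 20 * b4.repr b 2) • w ^ 2 + (b4.repr b 1 + 20 * b4.repr b 3) • w ^ 3 := by
    conv_lhs => rw [eq_comb b]
    exact w_sq_mul_comb _ _ _ _
  rw [h5, map_smul, hw, Finsupp.coe_smul, Pi.smul_apply, coords_comb, smul_eq_mul]

/-- The elements of `J` have vanishing `1, w`-coordinates and `w³`-coordinate in `5ℤ/25`. -/
theorem coords_of_mem_J {y : R8} (hy : y ∈ J) :
    b4.repr y 0 = 0 ∧ b4.repr y 1 = 0 ∧ ∃ e : ZMod 25, b4.repr y 3 = 5 * e := by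
  obtain ⟨b, rfl⟩ := (mem_J_iff y).1 hy
  have h25 : ∀ c : ZMod 25, (5 : ZMod 25) * (20 * c) = 0 := by decide
  refine ⟨?_, ?_, ⟨b4.repr b 1, ?_⟩⟩
  · rw [coords_five_w_sq_mul]
    exact h25 _
  · rw [coords_five_w_sq_mul]
    exact h25 _
  · rw [coords_five_w_sq_mul]
    have : ∀ c d : ZMod 25, (5 : ZMod 25) * (c + 20 * d) = 5 * c := by decide
    exact this _ _

/-- **`w³ y ∈ J` forces `y ∈ (w³)`**: the `1, w`-coordinates `20c₁, 20c₂` of `w³ y` vanish and its `w³`-coordinate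
`c₀ + 20c₂` lies in `5ℤ/25`, so `c₀, c₁, c₂ ∈ 5ℤ/25` and `y ∈ 5R8 + (w³) = (w³)`. -/
theorem mem_W3_of_w_cube_mul_mem_J {y : R8} (h : w ^ 3 * y ∈ J) : y ∈ W3 := by
  obtain ⟨h0, h1, e, he⟩ := coords_of_mem_J h
  rw [eq_comb y, w_cube_mul_comb, coords_comb] at h0 h1 he
  have h0' : 20 * b4.repr y 1 = 0 := h0
  have h1' : 20 * b4.repr y 2 = 0 := h1
  have he' : b4.repr y 0 + 20 * b4.repr y 2 = 5 * e := he
  obtain ⟨d1, hd1⟩ := eq_five_mul_of_twenty_mul_eq_zero _ h0'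
  obtain ⟨d2, hd2⟩ := eq_five_mul_of_twenty_mul_eq_zero _ h1'
  have hc0 : ∃ d0 : ZMod 25, b4.repr y 0 = 5 * d0 := by
    refine ⟨e, ?_⟩
    have : b4.repr y 0 = 5 * e - 20 * b4.repr y 2 := by rw [← he']; ring
    rw [this, hd2]
    exact (by decide : ∀ e d : ZMod 25, 5 * e - 20 * (5 * d) = 5 * e) e d2
  obtain ⟨d0, hd0⟩ := hc0
  rw [mem_W3_iff]
  have h5 := five_eq
  refine ⟨(w ^ 3 - w) * (algebraMap (ZMod 25) R8 d0 + algebraMap (ZMod 25) R8 d1 * w +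
    algebraMap (ZMod 25) R8 d2 * w ^ 2) + algebraMap (ZMod 25) R8 (b4.repr y 3), ?_⟩
  conv_lhs => rw [eq_comb y]
  rw [hd0, hd1, hd2]
  simp only [smul_eq_num, map_mul, map_ofNat]
  rw [h5]
  ring

/-- Multiplication by `q(w³)` on `R6`. -/
def mulW3 : R6 →+ R6 := AddMonoidHom.mulLeft (q (w ^ 3))

/-- The range of `q(w³) ·` is `I₆`. -/
theorem mulW3_range : mulW3.range = I6.toAddSubgroup := by
  ext x
  rw [AddMonoidHom.mem_range, Submodule.mem_toAddSubgroup, mem_I6_iff]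
  constructor
  · rintro ⟨z, hz⟩
    obtain ⟨y, rfl⟩ := q_surjective z
    exact ⟨y, by rw [← hz]; show q (w ^ 3) * q y = _; rw [← map_mul]⟩
  · rintro ⟨y, rfl⟩
    exact ⟨q y, by show q (w ^ 3) * q y = _; rw [← map_mul]⟩

/-- The kernel of `q(w³) ·` is `I₆`. -/
theorem mulW3_ker : mulW3.ker = I6.toAddSubgroup := by
  ext x
  rw [AddMonoidHom.mem_ker, Submodule.mem_toAddSubgroup]
  obtain ⟨y, rfl⟩ := q_surjective x
  show q (w ^ 3) * q y = 0 ↔ _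
  rw [← map_mul, q_eq_zero_iff, q_mem_I6_iff]
  exact ⟨mem_W3_of_w_cube_mul_mem_J, fun hy => J_le_W3_aux hy⟩
where
  /-- `y ∈ (w³) → w³ y ∈ J`: `w³ · w³ b = w⁶ b ∈ J`. -/
  J_le_W3_aux {y : R8} (hy : y ∈ W3) : w ^ 3 * y ∈ J := by
    obtain ⟨b, rfl⟩ := (mem_W3_iff y).1 hy
    rw [mem_J_iff]
    refine ⟨4 * b, ?_⟩
    have h6 := w_pow_six
    linear_combination b * h6

/-- **`|I₆| = 125`**: `|R6| = |ker| · |range| = |I₆|²`. -/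
theorem natCard_I6 : Nat.card I6 = 125 := by
  have h1 := AddSubgroup.card_eq_card_quotient_mul_card_addSubgroup mulW3.ker
  have h2 : Nat.card (R6 ⧸ mulW3.ker) = Nat.card mulW3.range :=
    Nat.card_congr (QuotientAddGroup.quotientKerEquivRange mulW3).toEquiv
  rw [h2, mulW3_range, mulW3_ker] at h1
  have h4 : Nat.card I6.toAddSubgroup = Nat.card I6 :=
    Nat.card_congr (Equiv.subtypeEquivRight fun x => Submodule.mem_toAddSubgroup I6)
  rw [h4, natCard_R6] at h1
  exact Nat.mul_self_inj.1 (h1.symm.trans (by norm_num : (15625 : ℕ) = 125 * 125))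

/-- `|I₆| = 125 = |𝒪/𝔭⁶|^{1/2}`. -/
theorem card_I6 : Fintype.card I6 = 125 := by
  rw [← Nat.card_eq_fintype_card, natCard_I6]

/-- `κ = 1/125` satisfies `κ |I₆| = 1`. -/
theorem kappa_mul_card_six : (1 / 125 : ℂ) * (Fintype.card I6 : ℂ) = 1 := by
  rw [card_I6]
  norm_num

/-- **The conductor-`6` root number at `𝔭 | 5` with `κ = 1/125`**: `ε(½, ρ, ψ̃₆) = ρ(ϖ)^n ρ(a₀)^{−1}`, `a₀` a `σ₆`-fixed
unit `≡ a` mod `I₆`, `ρ(a₀)² = 1`. -/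
theorem eps_six_half (n : ℕ) (ρ : LocalChar R6) (hσ : ∀ x, ρ.unit (conj6 x) = ρ.unit⁻¹ x) (a : R6ˣ)
    (hρ : LocalChar.Primitive psi6 I6 ρ a) :
    ∃ a₀ : R6ˣ, conj6 (a₀ : R6) = a₀ ∧ (a : R6) - a₀ ∈ I6 ∧ ρ.unit (a₀ : R6) * ρ.unit (a₀ : R6) = 1 ∧
      LocalChar.eps (1 / 125) n ρ psi6 = ρ.piVal ^ n * (ρ.unit (a₀ : R6))⁻¹ :=
  eps_six n ρ hσ a hρ _ kappa_mul_card_six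

end SixModel

end Summit.Ventures.HodgeRepro.PeriodCloser

end
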